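import Mathlib
import Literature.AlgebraicGeometry.Resolution.TranscendenceDefect
import Summits.ResolutionOfSingularities.ResolutionOfSingularities.Theorems.AbhyankarShadowsSemivaluationShadowsQfgRankOne
import HarnessLib

/-!
# A very good chart on a Perron transform of a prescribed frame (`stub_frameChart`)

Crux `SemivaluationShadows` (item `stmt-ResolutionOfSingularities-16757`, route
`ResolutionOfSingularities/AbhyankarShadows`), line `birth`, registered sub-goal `stub_frameChart`
(Step C of the specialisation reduction, used DOWNSTAIRS on a rank-one Abhyankar place), PROVED:
`frameChart` (binder form) and `stub_frameChart` (the registered one-term signature, by name).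

**Statement.** `k = k̄` of characteristic `p`, `K/k` finitely generated, `O ∋ k` a valuation ring
of `K` which is rational, Abhyankar (`transcendenceDefect k O = 0`) and of rank one (archimedean
value group); `T = (T₁, …, T_r)` a PRESCRIBED FRAME: non-zero elements of value `< 1` whose
values form a `ℤ`-basis of the value group; `A ⊆ O` finitely generated. Then there are a PERRON
TRANSFORM `T'ⱼ = ∏ᵢ Tᵢ ^ (C j i)` of `T` (`C ∈ GL_r(ℤ)`, values `< 1`) and a finitely generated
`R₁ ⊆ O` containing `A` and the `T'ⱼ`, with `Frac R₁ = K`, whose centre `𝔪_O ∩ R₁` is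
generated by the `T'ⱼ` and on which `v` is MONOMIAL in `T'`: every non-zero `a ∈ R₁` has
`v(a) = ∏ⱼ v(T'ⱼ)^{mⱼ}` with `m ∈ ℕ^r` (Knaf–Kuhlmann 2005, Thm. 1.1 with a prescribed frame;
Zariski–Perron).

**Proof (entirely from the tree's very good charts).**
1. As in `qfgRankOne`: rational ⇒ zero-dimensional; `transcendenceDefect = 0` ⇒
   `IsAbhyankarPlace` (`isAbhyankarPlace_top_of_transcendenceDefect_eq_zero`); a very good chart
   `(R₀, x)` of `K` (`PfaffLine.exists_chart_top`); absorption
   (`PfaffLine.exists_chart_absorbing`) of the generators of `A` and of the `Tᵢ`: a very good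
   chart `(R₂, x₂)` of `K` with `A ∪ T ⊆ R₂`.
2. Perron monomialization (`PfaffLine.stub_perronMonomialization`) of the `Tᵢ` on `(R₂, x₂)`:
   a very good chart `(R₃, x₃)` with `Tᵢ = x₃^{αᵢ} · uᵢ`, `αᵢ ∈ ℕⁿ`, `v(uᵢ) = 1`; inverting
   `∏ uᵢ` (`PfaffLine.exists_chart_adjoin_inv`) gives `(R₄, x₃)` with all `uᵢ^{±1} ∈ R₄`.
3. The frame generates the value group, so `v(x₃ⱼ) = v(T^{βⱼ})` with `βⱼ ∈ ℤ^r`; comparing the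
   two expansions, `ℤ`-independence of `v(T)` and of `v(x₃)` give `α β = 1` and `β α = 1`
   (`prod_zpow_of_monomial_mul`, `eq_single_of_valuation_eq_prod_zpow`), whence `n = r`
   (traces) and `T'ⱼ := T^{βⱼ} = x₃ⱼ · ∏ᵢ uᵢ^{β j i}` is `x₃ⱼ` times a unit of `R₄`: so
   `(T') R₄ = (x₃) R₄ =` centre, `v(T'ⱼ) = v(x₃ⱼ) < 1`, the `v(T'ⱼ)` are `ℤ`-independent
   (`PfaffLine.perron_valIndep_of_matrix`), and every non-zero `a ∈ R₄` has a dominant monomial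
   in `T'` (`PfaffLine.stub_perronDominantTerm`, as `valuation_eq_prod_pow_of_chart`).

## Sources

* H. Knaf, F.-V. Kuhlmann, *Abhyankar places admit local uniformization in any characteristic*,
  Ann. Sci. ÉNS 38 (2005), Thm. 1.1, Lemma 4.2 and proof of Thm. 4.1. [KnafKuhlmann2005]
* O. Zariski, *Local uniformization on algebraic varieties*, Ann. of Math. 41 (1940) (Perron
  transforms).
-/

-- single-problem summit: the doubled namespace component `ResolutionOfSingularities` is forced
set_option linter.dupNamespace false

noncomputable section

open IsLocalRing Literature.AlgebraicGeometry.Resolution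

namespace Summit.ResolutionOfSingularities.ResolutionOfSingularities.Theorems

/-! ## Monomial algebra -/

/-- Integer powers of `z` lie in a subalgebra containing `z` and `z⁻¹`. [folklore] -/
theorem zpow_mem_of_mem_of_inv_mem {k K : Type} [Field k] [Field K] [Algebra k K]
    {A : Subalgebra k K} {z : K} (hz : z ∈ A) (hz' : z⁻¹ ∈ A) (c : ℤ) : z ^ c ∈ A := by
  obtain ⟨n, rfl | rfl⟩ := c.eq_nat_or_neg
  · rw [zpow_natCast]; exact A.pow_mem hz n
  · rw [zpow_neg, zpow_natCast, ← inv_pow]; exact A.pow_mem hz' n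

/-- **Substituting a monomial expansion into a Laurent monomial.** If `yᵢ = z^{Aᵢ} · uᵢ` for all
`i`, then `y^c = z^{∑ cᵢ Aᵢ} · ∏ uᵢ^{cᵢ}`. [folklore] -/
theorem prod_zpow_of_monomial_mul {K : Type} [Field K] {a b : ℕ} (z : Fin b → K)
    (hz0 : ∀ j, z j ≠ 0) (y u : Fin a → K) (A : Matrix (Fin a) (Fin b) ℤ)
    (hy : ∀ i, y i = (∏ j, z j ^ (A i j)) * u i) (c : Fin a → ℤ) :
    (∏ i, y i ^ (c i)) = (∏ j, z j ^ ((∑ i, c i • A i) j)) * ∏ i, u i ^ (c i) := by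
  rw [prod_zpow_sum z hz0, ← Finset.prod_mul_distrib]
  refine Finset.prod_congr rfl fun i _ => ?_
  rw [hy i, mul_zpow, prod_zpow_zsmul]

/-- Rows of a matrix product as linear combinations of rows. [folklore] -/
theorem sum_smul_row_eq_mul_apply {a b c : ℕ} (A : Matrix (Fin a) (Fin b) ℤ)
    (B : Matrix (Fin b) (Fin c) ℤ) (i : Fin a) : (∑ j, A i j • B j) = (A * B) i := by
  funext l
  simp only [Finset.sum_apply, Pi.smul_apply, smul_eq_mul, Matrix.mul_apply]

/-- **Uniqueness of exponents.** If the values of the non-zero `yᵢ` are `ℤ`-independent and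
`v(yᵢ) = v(y^m)`, then `m` is the `i`-th unit vector. [folklore] -/
theorem eq_single_of_valuation_eq_prod_zpow {K : Type} [Field K] (O : ValuationSubring K)
    {a : ℕ} (y : Fin a → K) (hy0 : ∀ i, y i ≠ 0)
    (hind : ∀ m : Fin a → ℤ, (∏ i, O.valuation (y i) ^ (m i)) = 1 → m = 0)
    (i : Fin a) (m : Fin a → ℤ)
    (h : O.valuation (y i) = O.valuation (∏ l, y l ^ (m l))) : m = Pi.single i 1 := by
  set e : Fin a → ℤ := Pi.single i 1 with he
  have key : (∏ l, y l ^ (m l)) = (∏ l, y l ^ ((m - e) l)) * y i := by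
    conv_lhs => rw [← sub_add_cancel m e]
    rw [prod_zpow_add y hy0, he, prod_zpow_single]
  have hyi : O.valuation (y i) ≠ 0 := (map_ne_zero _).mpr (hy0 i)
  rw [key, map_mul] at h
  have h1 : O.valuation (∏ l, y l ^ ((m - e) l)) = 1 := (mul_eq_right₀ hyi).mp h.symm
  rw [valuation_prod_zpow] at h1
  exact sub_eq_zero.mp (hind _ h1)

/-- A matrix all of whose rows are the unit vectors is the identity. [folklore] -/
theorem matrix_eq_one_of_row_eq_single {a : ℕ} (M : Matrix (Fin a) (Fin a) ℤ)
    (h : ∀ i, M i = Pi.single i 1) : M = 1 := by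
  ext i l
  rw [h i, Matrix.one_apply, Pi.single_apply]
  by_cases hil : i = l
  · subst hil; simp
  · simp [hil, Ne.symm hil]

/-- The rows of the identity matrix are the unit vectors. [folklore] -/
theorem matrix_one_row {a : ℕ} (j : Fin a) : (1 : Matrix (Fin a) (Fin a) ℤ) j = Pi.single j 1 :=
  funext fun _ => Matrix.one_eq_pi_single

/-! ## Dominant monomials on a very good chart -/

/-- **On a very good chart every non-zero element has a dominant monomial value.** Let `O` be a
valuation ring of `K ⊇ k` with archimedean value group and `(R, x)` a very good chart (centre of
`R ⊆ O` generated by the non-zero `xᵢ ∈ R` of `ℤ`-independent values). Then every non-zero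
`a ∈ R` has `v(a) = ∏ v(xᵢ)^{mᵢ}` for some `m ∈ ℕⁿ`: the dominant form of
`PfaffLine.stub_perronDominantTerm` and the strict ultrametric inequality.
[cite: KnafKuhlmann2005, Thm. 1.1] -/
theorem valuation_eq_prod_pow_of_chart {k K : Type} [Field k] [Field K] [Algebra k K]
    (O : ValuationSubring K)
    (hr1 : ∀ z w : K, O.valuation z < 1 → w ≠ 0 → ∃ N : ℕ, O.valuation z ^ N < O.valuation w)
    {n : ℕ} (R : Subalgebra k K) (hRO : R.toSubring ≤ O.toSubring) (x : Fin n → K)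
    (hx : ∀ i, x i ∈ R) (hx0 : ∀ i, x i ≠ 0)
    (hspan : Ideal.span (Set.range fun i => (⟨x i, hx i⟩ : R.toSubring)) =
      Ideal.comap (Subring.inclusion hRO) (maximalIdeal O))
    (hind : ∀ m : Fin n → ℤ, (∏ i, O.valuation (x i) ^ (m i)) = 1 → m = 0)
    {a : K} (haR : a ∈ R) (ha0 : a ≠ 0) :
    ∃ m : Fin n → ℕ, O.valuation a = ∏ i, O.valuation (x i) ^ (m i) := by
  classical
  obtain ⟨P, μ₀, hμ₀, hPR, hv1, hdom, hPe⟩ :=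
    PfaffLine.stub_perronDominantTerm k K O n R hRO x hx hx0 hspan hind hr1 a haR ha0
  have hvle : ∀ μ, O.valuation (P.coeff μ) ≤ 1 := fun μ =>
    (O.valuation_le_one_iff _).mpr (hRO (hPR μ))
  have hvmon : ∀ μ : Fin n →₀ ℕ,
      O.valuation (∏ i, x i ^ (μ i)) = ∏ i, O.valuation (x i) ^ (μ i) := fun μ => by
    simp only [map_prod, map_pow]
  refine ⟨μ₀, ?_⟩
  rw [← hPe, MvPolynomial.eval_eq', O.valuation.map_sum_eq_of_lt hμ₀]
  · rw [map_mul, hv1, one_mul, hvmon]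
  · intro μ hμ
    rw [Finset.mem_sdiff, Finset.mem_singleton] at hμ
    rw [map_mul, map_mul, hv1, one_mul, hvmon, hvmon]
    exact lt_of_le_of_lt (mul_le_of_le_one_left' (hvle μ)) (hdom μ hμ.1 hμ.2)

/-! ## The prescribed-frame chart (binder form) -/

/-- **A very good chart of `K` whose parameters are a Perron transform of a PRESCRIBED FRAME,
rank one** (Knaf–Kuhlmann 2005, Thm. 1.1 with the frame prescribed; Zariski–Perron). For
`k = k̄` of characteristic `p`, `K/k` finitely generated, `O ∋ k` a rational Abhyankar
(`transcendenceDefect = 0`) valuation ring of `K` with archimedean value group, a frame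
`T : Fin r → K` of non-zero elements of value `< 1` whose values form a `ℤ`-basis of the value
group, and a finitely generated `A ⊆ O`: there are a Perron transform `T'ⱼ = ∏ᵢ Tᵢ ^ (C j i)`
(`C D = D C = 1`) with `v(T'ⱼ) < 1` and a finitely generated `R₁ ⊆ O` containing `A` and `T'`,
with `Frac R₁ = K`, centre generated by `T'`, and every non-zero `a ∈ R₁` of value a monomial
in the `v(T'ⱼ)`. Proof: very good chart + absorption of `A ∪ T` (`qfgRankOne`'s route), Perron
monomialization of the `Tᵢ` (`Tᵢ = x₃^{αᵢ} uᵢ`), inversion of the units `uᵢ`; the frame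
generates the value group, so the exponent matrix `α` is unimodular with inverse `β`
(`v(x₃ⱼ) = v(T^{βⱼ})`), `n = r`, and `T' := T^β = x₃ · (units)` generates the same centre.
[cite: KnafKuhlmann2005, Thm. 1.1] -/
theorem frameChart (p : ℕ) (hp : p.Prime) (k K : Type) [Field k] [CharP k p] [IsAlgClosed k]
    [Field K] [Algebra k K] (hfg : (⊤ : IntermediateField k K).FG) (O : ValuationSubring K)
    (hk : ∀ c : k, algebraMap k K c ∈ O)
    (hrat : ∀ x : K, x ∈ O → ∃ c : k, O.valuation (x - algebraMap k K c) < 1)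
    (hD : transcendenceDefect k O hk = 0)
    (hr1 : ∀ z w : K, O.valuation z < 1 → w ≠ 0 → ∃ N : ℕ, O.valuation z ^ N < O.valuation w)
    (r : ℕ) (T : Fin r → K) (hT0 : ∀ i, T i ≠ 0) (hT1 : ∀ i, O.valuation (T i) < 1)
    (hTgen : ∀ z : K, z ≠ 0 → ∃ m : Fin r → ℤ, O.valuation z = ∏ i, O.valuation (T i) ^ (m i))
    (hTind : ∀ m : Fin r → ℤ, (∏ i, O.valuation (T i) ^ (m i)) = 1 → m = 0)
    (A : Subalgebra k K) (hA : A.FG) (hAO : A.toSubring ≤ O.toSubring) :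
    ∃ (T' : Fin r → K) (C D : Matrix (Fin r) (Fin r) ℤ), C * D = 1 ∧ D * C = 1 ∧
      (∀ j, T' j = ∏ i, T i ^ C j i) ∧ (∀ j, O.valuation (T' j) < 1) ∧
      ∃ (R₁ : Subalgebra k K) (h₁O : R₁.toSubring ≤ O.toSubring) (hT' : ∀ j, T' j ∈ R₁),
        A ≤ R₁ ∧ R₁.FG ∧ IsFractionRing R₁ K ∧
        Ideal.span (Set.range fun j => (⟨T' j, hT' j⟩ : R₁.toSubring)) =
          Ideal.comap (Subring.inclusion h₁O) (maximalIdeal O) ∧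
        ∀ a : K, a ∈ R₁ → a ≠ 0 → ∃ m : Fin r → ℕ,
          O.valuation a = ∏ j, O.valuation (T' j) ^ (m j) := by
  classical
  -- (1) rational ⇒ zero-dimensional; Abhyankar place; a very good chart of `K`
  have hzd : ∀ x : K, x ∈ O → ∃ f : Polynomial k, f ≠ 0 ∧ Polynomial.aeval x f ∈ O.nonunits := by
    intro x hx
    obtain ⟨c, hc⟩ := hrat x hx
    refine ⟨Polynomial.X - Polynomial.C c, Polynomial.X_sub_C_ne_zero c, ?_⟩
    rw [map_sub, Polynomial.aeval_X, Polynomial.aeval_C, ValuationSubring.mem_nonunits_iff]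
    exact hc
  have hAbh : IsAbhyankarPlace O (algebraMap k K).fieldRange ⊤ :=
    isAbhyankarPlace_top_of_transcendenceDefect_eq_zero hfg O hk hD
  obtain ⟨s, hs⟩ := hfg
  obtain ⟨n, R₀, hR₀O, x₀, hx₀, hR₀fg, hfrac, hx₀0, hspan₀, hind₀, -⟩ :=
    PfaffLine.exists_chart_top PfaffLine.stub_henselRootChart PfaffLine.stub_perronMonomialization
      PfaffLine.stub_valueStep PfaffLine.stub_residueStep hp O hk hzd hAbh hr1 s hs
  -- absorb the non-zero generators of `A`
  obtain ⟨g, hg⟩ := hA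
  have hgA : ∀ z ∈ g, z ∈ A := fun z hz => by rw [← hg]; exact Algebra.subset_adjoin hz
  set g₁ : Finset K := g.filter fun z => z ≠ 0 with hg₁
  let a : Fin g₁.card → K := fun j => (g₁.equivFin.symm j : K)
  have hag₁ : ∀ j, a j ∈ g₁ := fun j => (g₁.equivFin.symm j).2
  have haO : ∀ j, a j ∈ O := fun j => hAO (hgA _ (Finset.mem_filter.mp (hag₁ j)).1)
  have ha0 : ∀ j, a j ≠ 0 := fun j => (Finset.mem_filter.mp (hag₁ j)).2
  obtain ⟨R₁, hR₁O, x₁, hx₁, hR₀R₁, hR₁fg, haR₁, hx₁0, hspan₁, hind₁⟩ :=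
    PfaffLine.exists_chart_absorbing PfaffLine.stub_perronMonomialization O hr1 R₀ hR₀O x₀ hx₀
      hR₀fg hfrac hx₀0 hspan₀ hind₀ a haO ha0
  have hgR₁ : ∀ z ∈ g, z ∈ R₁ := by
    intro z hz
    by_cases hz0 : z = 0
    · rw [hz0]; exact R₁.zero_mem
    · have hz₁ : z ∈ g₁ := Finset.mem_filter.mpr ⟨hz, hz0⟩
      have h := haR₁ (g₁.equivFin ⟨z, hz₁⟩)
      simpa [a] using h
  have hAR₁ : A ≤ R₁ := by
    rw [← hg, Algebra.adjoin_le_iff]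
    exact fun z hz => hgR₁ z hz
  -- absorb the frame
  have hfrac₁ : ∀ z : K, z ∈ Subfield.closure (R₁ : Set K) := fun z =>
    Subfield.closure_mono (fun w hw => hR₀R₁ hw) (hfrac z)
  have hTO : ∀ i, T i ∈ O := fun i => (O.valuation_le_one_iff _).mp (hT1 i).le
  obtain ⟨R₂, hR₂O, x₂, hx₂, hR₁R₂, hR₂fg, hTR₂, hx₂0, hspan₂, hind₂⟩ :=
    PfaffLine.exists_chart_absorbing PfaffLine.stub_perronMonomialization O hr1 R₁ hR₁O x₁ hx₁
      hR₁fg hfrac₁ hx₁0 hspan₁ hind₁ T hTO hT0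
  -- (2) Perron monomialization of the `T i`, and inversion of the unit parts
  obtain ⟨R₃, hR₃O, x₃, hx₃, hR₂R₃, hR₃fg, -, hx₃0, hspan₃, hind₃, -, hmono, -⟩ :=
    PfaffLine.stub_perronMonomialization k K O n R₂ hR₂O x₂ hx₂ hR₂fg hx₂0 hspan₂ hind₂ hr1 r T
      (fun i => ⟨hTR₂ i, hT0 i⟩) 0 (fun j => Fin.elim0 j) (fun j => Fin.elim0 j)
  choose α u huR₃ hu1 hTu using hmono
  have hu0 : ∀ i, u i ≠ 0 := fun i h => by
    have := hu1 i; rw [h, map_zero] at this; exact zero_ne_one this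
  set U : K := ∏ i, u i with hU
  have hUR₃ : U ∈ R₃ := R₃.prod_mem fun i _ => huR₃ i
  have hU1 : O.valuation U = 1 := by
    rw [hU, map_prod]
    exact Finset.prod_eq_one fun i _ => hu1 i
  obtain ⟨R₄, hR₄O, hx₄, hR₃R₄, hUinv, hR₄fg, -, hspan₄⟩ :=
    PfaffLine.exists_chart_adjoin_inv O R₃ hR₃O x₃ hx₃ hR₃fg hspan₃ hUR₃ hU1
  have huR₄ : ∀ i, u i ∈ R₄ := fun i => hR₃R₄ (huR₃ i)
  have huinv : ∀ i, (u i)⁻¹ ∈ R₄ := by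
    intro i
    have hP0 : (∏ i' ∈ Finset.univ.erase i, u i') ≠ 0 :=
      Finset.prod_ne_zero_iff.mpr fun i' _ => hu0 i'
    have h : (u i)⁻¹ = U⁻¹ * ∏ i' ∈ Finset.univ.erase i, u i' := by
      rw [hU, ← Finset.mul_prod_erase _ _ (Finset.mem_univ i), mul_inv, mul_assoc,
        inv_mul_cancel₀ hP0, mul_one]
    rw [h]
    exact R₄.mul_mem hUinv (R₄.prod_mem fun i' _ => huR₄ i')
  have humon : ∀ c : Fin r → ℤ, (∏ i, u i ^ (c i)) ∈ R₄ := fun c =>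
    R₄.prod_mem fun i _ => zpow_mem_of_mem_of_inv_mem (huR₄ i) (huinv i) (c i)
  -- (3) the two exponent matrices
  set D : Matrix (Fin r) (Fin n) ℤ := Matrix.of fun i j => (α i j : ℤ) with hDdef
  have hTD : ∀ i, T i = (∏ j, x₃ j ^ (D i j)) * u i := fun i => by
    rw [hTu i, ← prod_zpow_natCast x₃ (α i)]
    rfl
  choose β hβ using fun j => hTgen (x₃ j) (hx₃0 j)
  set C : Matrix (Fin n) (Fin r) ℤ := Matrix.of fun j i => β j i with hCdef
  have hvC : ∀ j, O.valuation (x₃ j) = O.valuation (∏ i, T i ^ (C j i)) := fun j => by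
    rw [valuation_prod_zpow]
    exact hβ j
  have hC0 : ∀ j, (∏ i, T i ^ (C j i)) ≠ 0 := fun j => prod_zpow_ne_zero T hT0 (C j)
  -- `x₃ j = T^{C j} · v j` with `v j` of value `1`
  set v : Fin n → K := fun j => x₃ j * (∏ i, T i ^ (C j i))⁻¹ with hvdef
  have hxC : ∀ j, x₃ j = (∏ i, T i ^ (C j i)) * v j := fun j => by
    show x₃ j = (∏ i, T i ^ (C j i)) * (x₃ j * (∏ i, T i ^ (C j i))⁻¹)
    rw [mul_left_comm, mul_inv_cancel₀ (hC0 j), mul_one]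
  have hv1 : ∀ j, O.valuation (v j) = 1 := fun j => by
    show O.valuation (x₃ j * (∏ i, T i ^ (C j i))⁻¹) = 1
    rw [map_mul, map_inv₀, ← hvC j, mul_inv_cancel₀ ((map_ne_zero _).mpr (hx₃0 j))]
  -- `D * C = 1` by `ℤ`-independence of `v(T)`
  have hDC : D * C = 1 := by
    refine matrix_eq_one_of_row_eq_single _ fun i => ?_
    refine eq_single_of_valuation_eq_prod_zpow O T hT0 hTind i ((D * C) i) ?_
    have h := prod_zpow_of_monomial_mul T hT0 x₃ v C hxC (D i)
    rw [sum_smul_row_eq_mul_apply] at h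
    have hvmon : O.valuation (∏ j, v j ^ (D i j)) = 1 := by
      rw [map_prod]
      exact Finset.prod_eq_one fun j _ => by rw [map_zpow₀, hv1, one_zpow]
    conv_lhs => rw [hTD i, h]
    rw [map_mul, map_mul, hvmon, mul_one, hu1, mul_one]
  -- `C * D = 1` by `ℤ`-independence of `v(x₃)`
  have hCD : C * D = 1 := by
    refine matrix_eq_one_of_row_eq_single _ fun j => ?_
    refine eq_single_of_valuation_eq_prod_zpow O x₃ hx₃0 hind₃ j ((C * D) j) ?_
    have h := prod_zpow_of_monomial_mul x₃ hx₃0 T u D hTD (C j)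
    rw [sum_smul_row_eq_mul_apply] at h
    have humon1 : O.valuation (∏ i, u i ^ (C j i)) = 1 := by
      rw [map_prod]
      exact Finset.prod_eq_one fun i _ => by rw [map_zpow₀, hu1, one_zpow]
    conv_lhs => rw [hxC j, h]
    rw [map_mul, map_mul, humon1, mul_one, hv1, mul_one]
  -- hence `n = r`
  have hnr : n = r := by
    have h := Matrix.trace_mul_comm D C
    rw [hDC, hCD, Matrix.trace_one, Matrix.trace_one, Fintype.card_fin, Fintype.card_fin] at h
    exact_mod_cast h.symm
  subst r
  -- the Perron transform `T' = T^C = x₃ · (units of R₄)`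
  set T' : Fin n → K := fun j => ∏ i, T i ^ (C j i) with hT'def
  have hT'j : ∀ j, T' j = ∏ i, T i ^ (C j i) := fun j => rfl
  set w : Fin n → K := fun j => ∏ i, u i ^ (C j i) with hwdef
  have hT'eq : ∀ j, T' j = x₃ j * w j := fun j => by
    have h := prod_zpow_of_monomial_mul x₃ hx₃0 T u D hTD (C j)
    rw [sum_smul_row_eq_mul_apply, hCD, matrix_one_row, prod_zpow_single] at h
    exact h
  have hw0 : ∀ j, w j ≠ 0 := fun j => prod_zpow_ne_zero u hu0 (C j)
  have hwR : ∀ j, w j ∈ R₄ := fun j => humon (C j)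
  have hw1 : ∀ j, O.valuation (w j) = 1 := fun j => by
    show O.valuation (∏ i, u i ^ (C j i)) = 1
    rw [map_prod]
    exact Finset.prod_eq_one fun i _ => by rw [map_zpow₀, hu1, one_zpow]
  have hwinvR : ∀ j, (w j)⁻¹ ∈ R₄ := fun j => by
    show (∏ i, u i ^ (C j i))⁻¹ ∈ R₄
    rw [← Finset.prod_inv_distrib]
    exact R₄.prod_mem fun i _ => by
      rw [← zpow_neg]
      exact zpow_mem_of_mem_of_inv_mem (huR₄ i) (huinv i) _
  have hT'R : ∀ j, T' j ∈ R₄ := fun j => by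
    rw [hT'eq j]
    exact R₄.mul_mem (hx₄ j) (hwR j)
  have hT'0 : ∀ j, T' j ≠ 0 := fun j => prod_zpow_ne_zero T hT0 (C j)
  have hx₃eq : ∀ j, x₃ j = T' j * (w j)⁻¹ := fun j => by
    rw [hT'eq j, mul_inv_cancel_right₀ (hw0 j)]
  -- the centre of `R₄` is generated by `T'`
  have hspanT : Ideal.span (Set.range fun j => (⟨T' j, hT'R j⟩ : R₄.toSubring)) =
      Ideal.comap (Subring.inclusion hR₄O) (maximalIdeal O) := by
    rw [← hspan₄]
    apply le_antisymm
    · rw [Ideal.span_le]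
      rintro _ ⟨j, rfl⟩
      have heq : (⟨T' j, hT'R j⟩ : R₄.toSubring) = ⟨x₃ j, hx₄ j⟩ * ⟨w j, hwR j⟩ :=
        Subtype.ext (hT'eq j)
      show (⟨T' j, hT'R j⟩ : R₄.toSubring) ∈ Ideal.span _
      rw [heq]
      exact Ideal.mul_mem_right _ _ (Ideal.subset_span ⟨j, rfl⟩)
    · rw [Ideal.span_le]
      rintro _ ⟨j, rfl⟩
      have heq : (⟨x₃ j, hx₄ j⟩ : R₄.toSubring) = ⟨T' j, hT'R j⟩ * ⟨(w j)⁻¹, hwinvR j⟩ :=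
        Subtype.ext (hx₃eq j)
      show (⟨x₃ j, hx₄ j⟩ : R₄.toSubring) ∈ Ideal.span _
      rw [heq]
      exact Ideal.mul_mem_right _ _ (Ideal.subset_span ⟨j, rfl⟩)
  -- values of `T'`: `< 1` and `ℤ`-independent
  have hx₃lt : ∀ j, O.valuation (x₃ j) < 1 := fun j =>
    (PfaffLine.perron_mem_centre_iff O R₄ hR₄O (hx₄ j)).mp
      (by rw [← hspan₄]; exact Ideal.subset_span ⟨j, rfl⟩)
  have hT'lt : ∀ j, O.valuation (T' j) < 1 := fun j => by
    rw [hT'eq j, map_mul, hw1 j, mul_one]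
    exact hx₃lt j
  have hindT' : ∀ m : Fin n → ℤ, (∏ j, O.valuation (T' j) ^ (m j)) = 1 → m = 0 :=
    PfaffLine.perron_valIndep_of_matrix O T hT0 hTind C D hCD T' hT'j
  -- `Frac R₄ = K`
  have hR₀R₄ : R₀ ≤ R₄ := hR₀R₁.trans (hR₁R₂.trans (hR₂R₃.trans hR₃R₄))
  have hfracR₄ : ∀ z : K, ∃ a' ∈ R₄.toSubring, ∃ b' ∈ R₄.toSubring, z = a' / b' := by
    intro z
    have hz : z ∈ Subfield.closure (R₄ : Set K) :=
      Subfield.closure_mono (fun y hy => hR₀R₄ hy) (hfrac z)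
    obtain ⟨y, hy, y', hy', rfl⟩ := Subfield.mem_closure_iff.mp hz
    have hcl : Subring.closure (R₄ : Set K) = R₄.toSubring := Subring.closure_eq R₄.toSubring
    rw [hcl] at hy hy'
    exact ⟨y, hy, y', hy', rfl⟩
  have hfrR₄ : IsFractionRing R₄ K := isFractionRing_of_forall_exists_div R₄.toSubring hfracR₄
  -- conclusion
  refine ⟨T', C, D, hCD, hDC, hT'j, hT'lt, R₄, hR₄O, hT'R,
    hAR₁.trans (hR₁R₂.trans (hR₂R₃.trans hR₃R₄)), hR₄fg, hfrR₄, hspanT, fun b hb hb0 => ?_⟩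
  exact valuation_eq_prod_pow_of_chart O hr1 R₄ hR₄O T' hT'R hT'0 hspanT hindT' hb hb0

/-! ## The registered sub-goal, by name -/

/-- **SUB-GOAL `stub_frameChart` of line `birth` of crux `SemivaluationShadows`, PROVED** (the
registered one-term signature, by name): over an algebraically closed field of characteristic `p`,
a rational rank-one Abhyankar valuation ring of a finitely generated `K/k` admits, for every
prescribed frame `T` (non-zero, values `< 1` forming a `ℤ`-basis of the value group) and every
finitely generated `A ⊆ O`, a Perron transform `T'` of `T` and a finitely generated model
`R₁ ⊇ A ∪ T'` inside `O` with `Frac R₁ = K`, centre `(T')`, and `v` monomial in `T'` on `R₁` —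
`frameChart`. [cite: KnafKuhlmann2005, Thm. 1.1] -/
theorem stub_frameChart : ∀ p : ℕ, p.Prime → ∀ (k K : Type) [Field k] [CharP k p] [IsAlgClosed k] [Field K] [Algebra k K], (⊤ : IntermediateField k K).FG → ∀ (O : ValuationSubring K) (hk : ∀ c : k, algebraMap k K c ∈ O), (∀ x : K, x ∈ O → ∃ c : k, O.valuation (x - algebraMap k K c) < 1) → Literature.AlgebraicGeometry.Resolution.transcendenceDefect k O hk = 0 → (∀ z w : K, O.valuation z < 1 → w ≠ 0 → ∃ N : ℕ, O.valuation z ^ N < O.valuation w) → ∀ (r : ℕ) (T : Fin r → K), (∀ i, T i ≠ 0) → (∀ i, O.valuation (T i) < 1) → (∀ z : K, z ≠ 0 → ∃ m : Fin r → ℤ, O.valuation z = ∏ i, O.valuation (T i) ^ (m i)) → (∀ m : Fin r → ℤ, (∏ i, O.valuation (T i) ^ (m i)) = 1 → m = 0) → ∀ A : Subalgebra k K, A.FG → A.toSubring ≤ O.toSubring → ∃ (T' : Fin r → K) (C D : Matrix (Fin r) (Fin r) ℤ), C * D = 1 ∧ D * C = 1 ∧ (∀ j, T' j = ∏ i, T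 i ^ C j i) ∧ (∀ j, O.valuation (T' j) < 1) ∧ ∃ (R₁ : Subalgebra k K) (h₁O : R₁.toSubring ≤ O.toSubring) (hT' : ∀ j, T' j ∈ R₁), A ≤ R₁ ∧ R₁.FG ∧ IsFractionRing R₁ K ∧ Ideal.span (Set.range fun j => (⟨T' j, hT' j⟩ : R₁.toSubring)) = Ideal.comap (Subring.inclusion h₁O) (IsLocalRing.maximalIdeal O) ∧ ∀ a : K, a ∈ R₁ → a ≠ 0 → ∃ m : Fin r → ℕ, O.valuation a = ∏ j, O.valuation (T' j) ^ (m j) := by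
  intro p hp k K _ _ _ _ _ hfg O hk hrat hD hr1 r T hT0 hT1 hTgen hTind A hA hAO
  exact frameChart p hp k K hfg O hk hrat hD hr1 r T hT0 hT1 hTgen hTind A hA hAO

end Summit.ResolutionOfSingularities.ResolutionOfSingularities.Theorems

end
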